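import Summits.Schanuel.Schanuel.Theorems.RootDecomp1EGenericScale01

/-!
# RootDecomp1EGenericScale — lens 2, generation 38 «GENERIC-SCALE INDUCTION STEP» (kernel: radical descent over an arbitrary type function; cells below the E-R19 floor) — continuation (RootDecomp1EGenericScale02): §3 the private estimates and the extracted clash `type_clash`

(lens-2 g38 `GenericScale.lean` EDITION 2 [HOME/decomp-schanuel-lens-2/g38/GenericScale.lean EDITION 2 sha256 cf4f06e4…1307, 1762 l (ed.1 b58a0d29…; proof-only reshape `type_clash`, NOTE/EDITION2 L1842, writer re-check L1845) + GenericScaleCtrl ed.2 84ae4551… + NODE-g38.md ffd0a60c…; NODE L1822 / REQUEST L1823; critic ACK + OBJECTION L1800, VERDICT L1833]; port by census-1 gen 16 in six parts — see the PORT NOTE of part 01; `--supports stmt-Schanuel-31409`; rung 0.)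
-/

noncomputable section

open Complex

namespace Summit.Schanuel.Schanuel.Theorems.RootDecomp1EGenericScale

open MvPolynomial
open Summit.Schanuel.Schanuel.Theorems.RootDecomp1KHyper (mvlen mvlen_nonneg abs_coeff_le_mvlen one_le_mvlen
  exists_ball_eval_ne_zero)
open Summit.Schanuel.Schanuel.Theorems.RootDecomp1BRadicalDescent

/-! ## §3 THE KERNEL: radical descent over an arbitrary type function -/

section Kernel

variable {n : ℕ}

/-- `x^k ≤ exp (k x)` for `x ≥ 0`. -/
private theorem pow_le_exp_mul {x : ℝ} (hx : 0 ≤ x) (k : ℕ) : x ^ k ≤ Real.exp (k * x) := by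
  rw [Real.exp_nat_mul]
  exact pow_le_pow_left₀ hx (by linarith [Real.add_one_le_exp x]) k

/-- `q ≤ exp q` for a natural number `q`. -/
private theorem natCast_le_exp (q : ℕ) : (q : ℝ) ≤ Real.exp q := by linarith [Real.add_one_le_exp (q : ℝ)]

/-- **the kernel's final arithmetic clash** (extracted, context-free): the bounds
`V ≤ A ≤ (Kl + 1)·e^{cU q²}·d`, `d < e^{−q³}·V`, `Kl + cU q² ≤ q³` with `0 ≤ Kl`, `0 ≤ V` are
contradictory. [folklore] -/
theorem type_clash {Kl cU q A V d : ℝ} (hKl : 0 ≤ Kl) (hV : 0 ≤ V)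
    (hclashq : Kl + cU * q ^ 2 ≤ q ^ 3) (hlow : V ≤ A)
    (hup : A ≤ (Kl + 1) * Real.exp (cU * q ^ 2) * d) (hψ : d < Real.exp (-(q ^ 3)) * V) :
    False := by
  have hA : 0 < (Kl + 1) * Real.exp (cU * q ^ 2) := by positivity
  have hexp : (Kl + 1) * Real.exp (cU * q ^ 2) * Real.exp (-(q ^ 3)) ≤ 1 := by
    have h1 : Kl + 1 ≤ Real.exp Kl := Real.add_one_le_exp Kl
    calc (Kl + 1) * Real.exp (cU * q ^ 2) * Real.exp (-(q ^ 3))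
        ≤ Real.exp Kl * Real.exp (cU * q ^ 2) * Real.exp (-(q ^ 3)) := by gcongr
      _ = Real.exp (Kl + cU * q ^ 2 + -(q ^ 3)) := by rw [← Real.exp_add, ← Real.exp_add]
      _ ≤ Real.exp 0 := Real.exp_le_exp.2 (by linarith only [hclashq])
      _ = 1 := Real.exp_zero
  have hlt : A < V :=
    calc A ≤ (Kl + 1) * Real.exp (cU * q ^ 2) * d := hup
      _ < (Kl + 1) * Real.exp (cU * q ^ 2) * (Real.exp (-(q ^ 3)) * V) :=
          mul_lt_mul_of_pos_left hψ hA
      _ = ((Kl + 1) * Real.exp (cU * q ^ 2) * Real.exp (-(q ^ 3))) * V := by ring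
      _ ≤ 1 * V := mul_le_mul_of_nonneg_right hexp hV
      _ = V := one_mul _
  exact absurd (hlow.trans_lt hlt) (lt_irrefl _)

end Kernel

end Summit.Schanuel.Schanuel.Theorems.RootDecomp1EGenericScale

end
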